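import Summits.Ventures.PercRepro.S1KillMixedCells
import Summits.Ventures.PercRepro.S1ChainCoNullCellsTP
import Summits.Ventures.PercRepro.S1TriangleLeverExact

/-!
# PercRepro — THE CONSUMERS WITH A SUPPLIED TRIANGLE BOUND (p2, gen 26; SUBCLAIM-S1 §6.10)

The consumers derive their triangle cap `P` from the one-step lever and the table; with `triT` (S1TriangleLeverExact)
the true range of `t` is shorter (`triT 6 15 = 7` against the lever's `8` on the `(9, 6)` core), and the lines above it
— which no four-circuit cap closes — need not be priced. The two consumers below take `s₃ ≤ P` as a hypothesis.

* **`rls_of_kill_case_mixed_capT'`** — the mixed kill consumer with `s₃ ≤ P` supplied;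
* **`rls_of_ladder_case_chain_conull_capTP'`** — the pruned conull consumer with `s₃ ≤ P` supplied on the coloop-free part.
Axioms: standard.
-/

open scoped Matroid

namespace PercRepro

namespace S1

open Set

variable {α : Type}

/-- **THE COLOOP-FREE CASE OF A CELL BY THE MIXED KILL WITH PER-`t` CAPS AND A SUPPLIED TRIANGLE BOUND** (`s₃ ≤ P`,
e.g. from `triT`): a coloop-free `e`-free core of rank
`p ≥ 5` on `p + d` points (`d ≥ 4`) with the triangle cap `P`, the four-circuit cap `S t` at triangle count `t`
(supplied) and the five-circuit cap `S5` satisfies `RLS` at `(p, 4)` once, at every `t ≤ P`, the two kernel lines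
pass: `s₄ < m₄ t` — the plain line at the cap `m₄ t − 1` with the kill of `mk t ≤ t` triangles; `s₄ ≥ m₄ t` — the
line at the cap `S t` with the kill of `mk t` triangles and `m₄ t` four-circuits. -/
theorem rls_of_kill_case_mixed_capT' (M : Matroid α) [M.Finite] {p d : ℕ}
    (hR : M.eRank = (p : ℕ∞)) (hn : M.E.ncard = p + d)
    (hfree : ∀ e ∈ M.E, ∃ A ⊆ M.E \ {e}, e ∉ M.closure A ∧ e ∉ M.closure ((M.E \ {e}) \ A))
    (hc : M.coloops = ∅) (hp : 5 ≤ p) (hd4 : 4 ≤ d) {P S5 : ℕ} (S : ℕ → ℕ)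
    (hP' : {C : Set α | M.IsCircuit C ∧ C.ncard = 3}.ncard ≤ P)
    (hScap : ∀ (N : Matroid α) [N.Finite],
      (∀ e ∈ N.E, ∃ A ⊆ N.E \ {e}, e ∉ N.closure A ∧ e ∉ N.closure ((N.E \ {e}) \ A)) →
      N.E.encard = N.eRank + ((d : ℕ) : ℕ∞) → N.E.ncard = p + d → N.coloops = ∅ →
      ∀ t, {C : Set α | N.IsCircuit C ∧ C.ncard = 3}.ncard = t →
      {C : Set α | N.IsCircuit C ∧ C.ncard = 4}.ncard ≤ S t)
    (hS5 : (p + d) * avgChain5b (d - 1) / (p + d - 5) ≤ S5)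
    (mk m₄ : ℕ → ℕ) (hmk : ∀ t ∈ Finset.range (P + 1), mk t ≤ t)
    (hsmall : ∀ t ∈ Finset.range (P + 1), ladderOK p p d t (m₄ t - 1) S5 (mk t * (p + d - 3).choose (p - 3))
      ((mk t).choose 2 * (p + d - 5).choose (p - 5)) = true)
    (hbig : ∀ t ∈ Finset.range (P + 1), ladderOK p p d t (S t) S5
      (mk t * (p + d - 3).choose (p - 3) + m₄ t * (p + d - 4).choose (p - 4))
      ((mk t + m₄ t).choose 2 * (p + d - 5).choose (p - 5)) = true) :
    ThmN.RLS M p 4 := by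
  classical
  have hd : M.E.encard = M.eRank + ((d - 1 + 1 : ℕ) : ℕ∞) := by
    rw [hR, ← M.ground_finite.cast_ncard_eq, hn, show d - 1 + 1 = d by omega]
    push_cast
    ring
  have hd' : M.E.encard = M.eRank + (((d - 1 : ℕ) : ℕ∞) + 1) := by rw [hd, Nat.cast_succ]
  have hdd : M.E.encard = M.eRank + ((d : ℕ) : ℕ∞) := by rw [hd, show d - 1 + 1 = d by omega]
  have hS' := hScap M hfree hdd hn hc _ rfl
  have hS5' := (ncard_fiveCircuits_le_of_coloopFree M hfree hd' hc hn (by omega)).trans hS5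
  have hC1 : ∀ L ⊆ M.E, M.eRk L = 2 → L.ncard ≤ 3 := by
    intro L hL hr
    have := ThmN.ncard_add_one_le_two_pow_of_eRk_le M (ThmN.not_isLoop_of_free M hfree) hfree 2 L hL hr.le
    omega
  set t := {C : Set α | M.IsCircuit C ∧ C.ncard = 3}.ncard with ht
  set u := {C : Set α | M.IsCircuit C ∧ C.ncard = 4}.ncard with hu
  have htI : t ∈ Finset.range (P + 1) := Finset.mem_range.2 (by omega)
  -- the triangles of the kill
  have h𝒯₃ : ∃ 𝒯₃ : Finset (Set α), 𝒯₃.card = mk t ∧ ∀ C ∈ 𝒯₃, M.IsCircuit C ∧ C.ncard = 3 := by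
    rcases Nat.eq_zero_or_pos (mk t) with h0 | hpos
    · exact ⟨∅, by rw [h0, Finset.card_empty], fun C hC => absurd hC (Finset.notMem_empty C)⟩
    · obtain ⟨𝒯, h1, h2⟩ := exists_finset_of_le_ncard hpos ((hmk t htI).trans (le_of_eq ht))
      exact ⟨𝒯, h1, h2⟩
  obtain ⟨𝒯₃, h𝒯₃card, h𝒯₃mem⟩ := h𝒯₃
  have hpair₃ : ∀ C ∈ 𝒯₃, ∀ C' ∈ 𝒯₃, C ≠ C' → 5 ≤ (C ∪ C').ncard := fun C hC C' hC' hne =>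
    five_le_ncard_union_of_triangles M hC1 (h𝒯₃mem C hC) (h𝒯₃mem C' hC') hne
  rw [ThmN.RLS_iff]
  rcases Nat.lt_or_ge u (m₄ t) with hsmallu | hbigu
  · -- `s₄ < m₄ t`: the plain line at the cap `m₄ t − 1` with the triangle kill
    have hw := weighted_of_ladderOK_kill M p p d t (m₄ t - 1) S5 0 0 hd4 hR hn hfree le_rfl (by omega) hS5' hp hp
      3 (by omega) 𝒯₃ h𝒯₃mem hpair₃ (by rw [h𝒯₃card]; simpa using hsmall t htI)
    simpa using hw
  · -- `s₄ ≥ m₄ t`: the mixed kill at the cap `S t`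
    have h𝒯₄ : ∃ 𝒯₄ : Finset (Set α), 𝒯₄.card = m₄ t ∧ ∀ C ∈ 𝒯₄, M.IsCircuit C ∧ C.ncard = 4 := by
      rcases Nat.eq_zero_or_pos (m₄ t) with h0 | hpos
      · exact ⟨∅, by rw [h0, Finset.card_empty], fun C hC => absurd hC (Finset.notMem_empty C)⟩
      · obtain ⟨𝒯, h1, h2⟩ := exists_finset_of_le_ncard hpos (hbigu.trans (le_of_eq hu))
        exact ⟨𝒯, h1, h2⟩
    obtain ⟨𝒯₄, h𝒯₄card, h𝒯₄mem⟩ := h𝒯₄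
    have hpair : ∀ C ∈ 𝒯₃ ∪ 𝒯₄, ∀ C' ∈ 𝒯₃ ∪ 𝒯₄, C ≠ C' → 5 ≤ (C ∪ C').ncard := by
      intro C hC C' hC' hne
      rw [Finset.mem_union] at hC hC'
      rcases hC with h3 | h4 <;> rcases hC' with h3' | h4'
      · exact hpair₃ C h3 C' h3' hne
      · exact five_le_ncard_union_of_triangle_four_circuit M (h𝒯₃mem C h3) (h𝒯₄mem C' h4')
      · rw [Set.union_comm]
        exact five_le_ncard_union_of_triangle_four_circuit M (h𝒯₃mem C' h3') (h𝒯₄mem C h4)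
      · exact five_le_ncard_union_of_four_circuits M (h𝒯₄mem C h4) (h𝒯₄mem C' h4') hne
    have hw := weighted_of_ladderOK_kill_mixed M p p d t (S t) S5 0 0 hd4 hR hn hfree le_rfl hS' hS5' hp hp
      𝒯₃ 𝒯₄ h𝒯₃mem h𝒯₄mem hpair (by rw [h𝒯₃card, h𝒯₄card]; simpa using hbig t htI)
    simpa using hw


/-- **ONE LADDER CASE BY THE CHAIN LEVERS WITH THE PER-PAIR KILL, THE CO-NULLITY CREDIT AND THE PER-`t` CAP,
`(B)`-LINES PRUNED, THE TRIANGLE BOUND SUPPLIED**: as `rls_of_ladder_case_chain_conull_capTP`, with `s₃ ≤ P` on the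
coloop-free part a hypothesis (`hPcap`). -/
theorem rls_of_ladder_case_chain_conull_capTP' (M : Matroid α) [M.Finite] {p0 p c d n : ℕ} (hp0 : p0 = p + c) (hnd : n = p0 + d)
    (hR : M.eRank = (p0 : ℕ∞)) (hn : M.E.ncard = n)
    (hfree : ∀ e ∈ M.E, ∃ A ⊆ M.E \ {e}, e ∉ M.closure A ∧ e ∉ M.closure ((M.E \ {e}) \ A))
    (hc : M.coloops.ncard = c) (hp : 6 ≤ p) (hd4 : 4 ≤ d) {P S5 : ℕ} (S : ℕ → ℕ)
    (hPcap : ∀ (N : Matroid α) [N.Finite],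
      (∀ e ∈ N.E, ∃ A ⊆ N.E \ {e}, e ∉ N.closure A ∧ e ∉ N.closure ((N.E \ {e}) \ A)) →
      N.E.encard = N.eRank + ((d : ℕ) : ℕ∞) → N.E.ncard = p + d → N.coloops = ∅ →
      {C : Set α | N.IsCircuit C ∧ C.ncard = 3}.ncard ≤ P)
    (hScap : ∀ (N : Matroid α) [N.Finite],
      (∀ e ∈ N.E, ∃ A ⊆ N.E \ {e}, e ∉ N.closure A ∧ e ∉ N.closure ((N.E \ {e}) \ A)) →
      N.E.encard = N.eRank + ((d : ℕ) : ℕ∞) → N.E.ncard = p + d → N.coloops = ∅ →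
      ∀ t, {C : Set α | N.IsCircuit C ∧ C.ncard = 3}.ncard = t →
      {C : Set α | N.IsCircuit C ∧ C.ncard = 4}.ncard ≤ S t)
    (hS5 : (p + d) * avgChain5b (d - 1) / (p + d - 5) ≤ S5)
    (rr : ℕ → ℕ)
    (hrr : ∀ t ∈ Finset.Icc 1 P, 1 ≤ rr t ∧ TriangleCap.cq3 (rr t - 1) < t ∧
      ∀ ν < rr t, TriangleCap.cq3 ν ≤ TriangleCap.cq3 (rr t - 1))
    (hzero : ladderOK p0 p d 0 (S 0) S5 (∑ j ∈ Finset.range c, 2 ^ (n - 1 - j))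
      (∑ j ∈ Finset.range c, w3plus (n - 1 - j)) = true)
    (hokA : ∀ t ∈ Finset.Icc 1 P, ∀ u ∈ Finset.Icc 3 (3 * rr t),
      killnullOK p0 p d t (S t) S5 ((∑ j ∈ Finset.range c, 2 ^ (n - 1 - j)) +
          (rr t * (p + d - 3).choose (p - 3) + zcred (p + d) p (p + d - u) (d + 1 - rr t)))
        ((∑ j ∈ Finset.range c, w3plus (n - 1 - j)) + killPairB (rr t) u (p + d) p)
        (exclXc (p + d) (p + d - u) (d + 1 - rr t) (S t) t (rr t)) = true)
    (hokB : ∀ t ∈ Finset.Icc 1 P, ∀ i ∈ Finset.Icc 1 (rr t - 1), ∀ u ∈ Finset.Icc 3 (3 * i),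
      t ≤ TriangleCap.cq3 (u - 2) →
      killnullOK p0 p d t (S t) S5 ((∑ j ∈ Finset.range c, 2 ^ (n - 1 - j)) +
          (i * (p + d - 3).choose (p - 3) + zcred (p + d) p (p + d - u) (d + 1 - rr t)))
        ((∑ j ∈ Finset.range c, w3plus (n - 1 - j)) + killPairB i u (p + d) p)
        (exclXc (p + d) (p + d - u) (d + 1 - rr t) (S t) t t) = true) :
    ThmN.RLS M p0 4 := by
  subst hp0
  have hR' : M.eRank = ((p + c : ℕ) : ℕ∞) := hR
  obtain ⟨N, hNfin, hNR, hNn, hNcol, hNfree, hNtop, hNmid⟩ := ladder_exact c M p hR' (by omega) (by omega) hfree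
  have hNn' : N.E.ncard = p + d := by omega
  have hNcol0 : N.coloops = ∅ := by
    have h0 : N.coloops.ncard = 0 := by omega
    exact (Set.ncard_eq_zero (N.ground_finite.subset N.coloops_subset_ground)).1 h0
  have hNd : N.E.encard = N.eRank + ((d - 1 + 1 : ℕ) : ℕ∞) := by
    rw [hNR, ← N.ground_finite.cast_ncard_eq, hNn', show d - 1 + 1 = d by omega]
    push_cast
    ring
  have hNd' : N.E.encard = N.eRank + (((d - 1 : ℕ) : ℕ∞) + 1) := by rw [hNd, Nat.cast_succ]
  have hNdd : N.E.encard = N.eRank + ((d : ℕ) : ℕ∞) := by rw [hNd, show d - 1 + 1 = d by omega]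
  have hP' : {C : Set α | N.IsCircuit C ∧ C.ncard = 3}.ncard ≤ P := hPcap N hNfree hNdd hNn' hNcol0
  have hS' := hScap N hNfree hNdd hNn' hNcol0 _ rfl
  have hS5' := (ncard_fiveCircuits_le_of_coloopFree N hNfree hNd' hNcol0 hNn' (by omega)).trans hS5
  -- the core facts of `N`
  have hL : ∀ e ∈ N.E, ¬ N.IsLoop e := ThmN.not_isLoop_of_free N hNfree
  have hs : ∀ e ∈ N.E, ∀ f ∈ N.E, e ≠ f → N.eRk {e, f} = 2 := by
    intro e he f hf hef
    have h2 : (2 : ℕ∞) ≤ N.eRk {e, f} :=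
      ThmN.two_le_eRk_of_two_le_ncard_of_free N hNfree (pair_subset he hf) (by rw [ncard_pair hef])
    have h3 : N.eRk {e, f} ≤ 2 := by
      have := N.eRk_le_encard {e, f}
      rwa [encard_pair hef] at this
    exact le_antisymm h3 h2
  have hcirc : ∀ C, N.IsCircuit C → 3 ≤ C.encard := ThmN.three_le_encard_of_circuit N hL hs
  have hC1 : ∀ L ⊆ N.E, N.eRk L = 2 → L.ncard ≤ 3 := by
    intro L hL' hr
    have := ThmN.ncard_add_one_le_two_pow_of_eRk_le N hL hNfree 2 L hL' hr.le
    omega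
  set t := {C : Set α | N.IsCircuit C ∧ C.ncard = 3}.ncard with ht
  set St := S t with hSt
  set A := ∑ j ∈ Finset.range c, 2 ^ (n - 1 - j) with hA
  set B := ∑ j ∈ Finset.range c, w3plus (n - 1 - j) with hB
  -- a kernel line applied to a triangle family `𝒯'` with union of size `u`, an exclusion `X` and a credit `Zc`
  have hline : ∀ (𝒯' : Finset (Set α)), (∀ C ∈ 𝒯', N.IsCircuit C ∧ C.ncard = 3) → ∀ u, (⋃ C ∈ 𝒯', C).ncard = u →
      ∀ (Sn : Set α), Sn ⊆ N.E → ∀ (r kk X : ℕ), N.eRk Sn + (r : ℕ∞) ≤ (Sn.ncard : ℕ∞) → d + 1 ≤ kk + r →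
      X ≤ {B : Set α | B ⊆ N.E ∧ B.ncard = 4 ∧ N.eRk B = 4 ∧ kk ≤ (B \ Sn).ncard}.ncard →
      ∀ (Zc : ℕ) (𝒵 : Finset (Set α)), (∀ A ∈ 𝒵, A ⊆ N.E ∧ p + 1 ≤ A.ncard ∧ N.eRk A < (p : ℕ∞)) → 𝒵.card = Zc →
      killnullOK (p + c) p d t St S5 (A + (𝒯'.card * (p + d - 3).choose (p - 3) + Zc))
        (B + killPairB 𝒯'.card u (p + d) p) X = true →
      phiK (p + c) 4 * (Matroid.topCount N p 4 : ℚ) + B ≤ (Matroid.midCount N p 4 : ℚ) + A := by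
    intro 𝒯' h𝒯' u hu Sn hSn r kk X hν hkk hX Zc 𝒵 h𝒵 hZc hok
    refine weighted_of_killnullOK_conull N (p + c) p d t St S5 A B X hd4 hNR hNn' hNfree le_rfl hS' hS5' hp
      (by omega) 𝒯' h𝒯' hu 𝒵 h𝒵 hSn hν hkk hX ?_
    rw [hZc]
    exact hok
  -- the weighted inequality on `N`
  have hw : phiK (p + c) 4 * (Matroid.topCount N p 4 : ℚ) + B ≤ (Matroid.midCount N p 4 : ℚ) + A := by
    rcases Nat.eq_zero_or_pos t with h0 | hpos
    · have hS0 : {C : Set α | N.IsCircuit C ∧ C.ncard = 4}.ncard ≤ S 0 := by rw [← h0]; exact hS'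
      exact weighted_of_ladderOK N (p + c) p d 0 (S 0) S5 A B hd4 hNR hNn' hNfree (by rw [← ht, h0]) hS0 hS5'
        (by omega) (by omega) hzero
    · have htI : t ∈ Finset.Icc 1 P := Finset.mem_Icc.2 ⟨hpos, hP'⟩
      obtain ⟨hr1, hcq, hmono⟩ := hrr t htI
      set r := rr t with hr
      have hcq' : TriangleCap.cq3 (r - 1) < (ThmN.triangles N).ncard := hcq
      obtain ⟨Sn, hSnE, 𝒯', h𝒯'tri, h𝒯'un, hu3r, hSnν, hcase⟩ := exists_chain_family N hNfree r hcq' hmono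
      have hSnfin : Sn.Finite := N.ground_finite.subset hSnE
      have hsubS : ∀ C ∈ 𝒯', C ⊆ Sn := fun C hC => by
        rw [← h𝒯'un]; exact fun x hx => Set.mem_iUnion₂.2 ⟨C, hC, hx⟩
      -- `𝒯'` is nonempty (`Sn` has nullity `≥ r ≥ 1`), so `|Sn| ≥ 3`
      have hne : 𝒯'.Nonempty := by
        by_contra h0
        rw [Finset.not_nonempty_iff_eq_empty] at h0
        rw [h0] at h𝒯'un
        simp only [Finset.notMem_empty, Set.iUnion_of_empty, Set.iUnion_empty] at h𝒯'un
        rw [← h𝒯'un, Set.ncard_empty, Matroid.eRk_empty, zero_add] at hSnν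
        have : r ≤ 0 := by exact_mod_cast hSnν
        omega
      have hSn3 : 3 ≤ Sn.ncard := by
        obtain ⟨C, hC⟩ := hne
        have := Set.ncard_le_ncard (hsubS C hC) hSnfin
        rw [(h𝒯'tri C hC).2] at this
        exact this
      set u := Sn.ncard with hu
      set m := (N.E \ Sn).ncard with hm
      have hmE : m + u = N.E.ncard := Set.ncard_sdiff_add_ncard_of_subset hSnE N.ground_finite
      have hmu : m = p + d - u := by omega
      have hu' : (⋃ C ∈ 𝒯', C).ncard = u := by rw [h𝒯'un]
      set k := d + 1 - r with hk
      -- the co-nullity family and its credit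
      have hZ : ∃ 𝒵 : Finset (Set α), (∀ A ∈ 𝒵, A ⊆ N.E ∧ p + 1 ≤ A.ncard ∧ N.eRk A < (p : ℕ∞)) ∧
          𝒵.card = zcred (p + d) p m k := by
        by_cases hkm : k ≤ m
        · obtain ⟨𝒵, h𝒵, h𝒵card⟩ := exists_conull_family N hNn' hSnE hSnν (by omega) hkm
          refine ⟨𝒵, h𝒵, ?_⟩
          rw [h𝒵card]
          unfold zcred
          rw [if_pos hkm]
        · refine ⟨∅, fun A hA => absurd hA (Finset.notMem_empty A), ?_⟩
          unfold zcred
          rw [if_neg hkm, Finset.card_empty]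
      obtain ⟨𝒵, h𝒵, hZc⟩ := hZ
      -- the exclusion credit is honest, with `o` outside triangles
      have hXgen : ∀ o, o ≤ t → {C : Set α | N.IsCircuit C ∧ C.ncard = 3 ∧ ¬ C ⊆ Sn}.ncard ≤ o →
          exclXc (p + d) m k St t (t - o) ≤
            {B : Set α | B ⊆ N.E ∧ B.ncard = 4 ∧ N.eRk B = 4 ∧ k ≤ (B \ Sn).ncard}.ncard := by
        intro o hot ho
        unfold exclXc
        split_ifs with hk24 hm2
        · obtain ⟨hm2', hk2'⟩ := hm2
          have h := excl_ge_two N hcirc hC1 (S := Sn) (by rw [← hm]; exact hm2')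
          rw [hNn'] at h
          have hexcl : exclCount (p + d) 2 2 = (p + d - 2).choose 2 := by
            unfold exclCount
            rw [show (2 : ℕ).choose 4 = 0 from Nat.choose_eq_zero_of_lt (by norm_num)]
            simp
          rw [hexcl, hk2']
          have h2 : {C : Set α | N.IsCircuit C ∧ C.ncard = 3 ∧ ¬ C ⊆ Sn}.ncard ≤ t - (t - o) := by omega
          omega
        · have h := excl_ge_all N hcirc Sn hk24.1 hk24.2
          rw [hNn', ← hm] at h
          unfold exclX
          have h2 : {C : Set α | N.IsCircuit C ∧ C.ncard = 3 ∧ ¬ C ⊆ Sn}.ncard * (p + d - 3) ≤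
              (t - (t - o)) * (p + d - 3) := Nat.mul_le_mul_right _ (by omega)
          omega
        · exact Nat.zero_le _
      rcases hcase with ⟨h𝒯'r, hout⟩ | ⟨h𝒯'r, hall⟩
      · -- (A) the chain of `r` triangles
        have hout0 : {C : Set α | N.IsCircuit C ∧ C.ncard = 3 ∧ ¬ C ⊆ Sn}.ncard + r ≤ t := hout
        have hout' : {C : Set α | N.IsCircuit C ∧ C.ncard = 3 ∧ ¬ C ⊆ Sn}.ncard ≤ t - r := by omega
        have hX := hXgen (t - r) (by omega) hout'
        have htr : t - (t - r) = r := by omega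
        rw [htr] at hX
        have huI : u ∈ Finset.Icc 3 (3 * r) := Finset.mem_Icc.2 ⟨hSn3, by omega⟩
        refine hline 𝒯' h𝒯'tri u hu' Sn hSnE r k _ hSnν (by omega) hX _ 𝒵 h𝒵 hZc ?_
        rw [h𝒯'r]
        have := hokA t htI u huI
        rwa [← hmu] at this
      · -- (B) every triangle inside `Sn`
        have hout0 : {C : Set α | N.IsCircuit C ∧ C.ncard = 3 ∧ ¬ C ⊆ Sn}.ncard ≤ 0 := by
          have hempty : {C : Set α | N.IsCircuit C ∧ C.ncard = 3 ∧ ¬ C ⊆ Sn} = ∅ := by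
            ext C
            simp only [Set.mem_setOf_eq, Set.mem_empty_iff_false, iff_false]
            rintro ⟨h1, h2, h3⟩
            exact h3 (hall C h1 h2)
          rw [hempty, Set.ncard_empty]
        have hX := hXgen 0 (Nat.zero_le _) hout0
        rw [Nat.sub_zero] at hX
        have hiI : 𝒯'.card ∈ Finset.Icc 1 (r - 1) := Finset.mem_Icc.2 ⟨Finset.card_pos.2 hne, by omega⟩
        have huI : u ∈ Finset.Icc 3 (3 * 𝒯'.card) := Finset.mem_Icc.2 ⟨hSn3, hu3r⟩
        -- the pruning: `t ≤ cq3 ν(Sn) ≤ cq3 (u − 2)`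
        have hprune : t ≤ TriangleCap.cq3 (u - 2) := by
          obtain ⟨ν, hν⟩ := exists_nullity N hSnE
          have h1 : {C : Set α | N.IsCircuit C ∧ C.ncard = 3}.ncard ≤ TriangleCap.cq3 ν :=
            ncard_triangles_le_cq3_of_subset N hNfree hSnE hall hν
          obtain ⟨C, hC⟩ := hne
          have h2 : (2 : ℕ∞) ≤ N.eRk Sn :=
            two_le_eRk_of_triangle_subset N hNfree (h𝒯'tri C hC).1 (h𝒯'tri C hC).2 (hsubS C hC)
          have hrk : N.eRk Sn ≠ ⊤ := ((N.eRk_le_encard Sn).trans_lt hSnfin.encard_lt_top).ne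
          obtain ⟨rS, hrS⟩ := ENat.ne_top_iff_exists.1 hrk
          rw [← hrS] at h2 hν
          rw [← hSnfin.cast_ncard_eq] at hν
          have h2' : 2 ≤ rS := by exact_mod_cast h2
          have hν' : Sn.ncard = rS + ν := by exact_mod_cast hν
          have hν2 : ν ≤ u - 2 := by omega
          exact h1.trans (cq3_mono hν2)
        refine hline 𝒯' h𝒯'tri u hu' Sn hSnE r k _ hSnν (by omega) hX _ 𝒵 h𝒵 hZc ?_
        have := hokB t htI 𝒯'.card hiI u huI hprune
        rwa [← hmu] at this
  rw [ThmN.RLS_iff, hNtop]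
  rw [hn] at hNmid
  have hmidQ : ((Matroid.midCount N p 4 : ℕ) : ℚ) + ((∑ j ∈ Finset.range c, 2 ^ (n - 1 - j) : ℕ) : ℚ) ≤
      ((Matroid.midCount M (p + c) 4 : ℕ) : ℚ) + ((∑ j ∈ Finset.range c, w3plus (n - 1 - j) : ℕ) : ℚ) := by
    exact_mod_cast hNmid
  linarith


end S1

end PercRepro
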